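import Literature.Probability.RandomPlanarGeometry.HexSAWBrickWallStripFugacityLevel0
import Literature.Probability.RandomPlanarGeometry.HexSAWBrickWallStripInsertion
import Literature.Probability.RandomPlanarGeometry.HexSAWBrickWallStripInsertionCore
import HarnessLib

/-!
# The four-column insertion and the level-`0` (printed, one-level) surface fugacity: `i(ω) ≤ i(Ψ(ω,R)) ≤ i(ω) + 4·|R|`, weighted core

Topic `Literature/Probability/RandomPlanarGeometry` (continues `HexSAWBrickWallStripFugacityLevel0.lean` — the
printed one-level partition functions `HexBW.stripZ₀ T n y = C_{T,n}(y,1)` (fugacity `y` per SURFACE = level-`0` vertex: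
bottom row AND dangling vertical bond, i.e. odd abscissa) and their growth rates `HexBW.stripMuY₀ T y = μ_T(y,1)` — and
`HexSAWBrickWallStripInsertion.lean` — the four-column insertion `HexBW.stripInsertion` of the door «HEX-STRIP-STRICT»:
(walk of `S_T`, admissible cut set `R`) ↦ walk of `S_{T+1}` of length `n + Σ cost`, injective).  This is the one-level
twin of `HexSAWBrickWallStripFugacityInsertion.lean` (same proofs; the surface test replaces the bottom-row test, and
the column map `σ(x) = x + 4k` preserves the parity of the abscissa, hence the surface class of every anchor).
Source of the statement served: N. R. Beaton, M. Bousquet-Mélou, J. de Gier, H. Duminil-Copin, A. J. Guttmann,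
Comm. Math. Phys. 326 (2014), arXiv:1109.0358v5, Proposition 7 (p. 11): "For `y > 0`, we have `μ_T(1,y) < μ_{T+1}(1,y)`"
(with Proposition 6, p. 10: `μ_T(y,1) = μ_T(1,y)`; proved there qualitatively, as "an adaptation to the honeycomb
lattice of results proved by van Rensburg, Orlandini and Whittington"); the lane proves it (next file) by its
insertion, whose effect on the surface weight is controlled HERE.

## What is proved (namespace `Literature.Probability.RandomPlanarGeometry.SAW.HexBW`)

* `StripInsertion.countP_surf_imageList` — the number `i` of surface vertices of the image satisfies
  `i(ω) ≤ i(Ψ(ω,R)) ≤ i(ω) + 4·|R|` (every anchor keeps its row and the parity of its column; the inserted cells of a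
  cut in the bottom row are at most four, and occur only for the unique strand of the cut in the bottom row);
* `bottomVisits₀_stripInsertion` — the same for the pair `HexBW.stripInsertion T n p R`;
* **`weighted_core₀`** — for `0 < x ≤ 1`, `y > 0`, `θ = min 1 (y^4)`:
  `C_{T,n}(y,1) xⁿ (1 + θ x^{4T+8})^{⌊n/(2(T+1))⌋} ≤ Σ_{m ≤ (4T+9)n} C_{T+1,m}(y,1) x^m`.
-/

noncomputable section

open Finset Filter Topology Literature.Probability.LatticeModels Literature.Probability.Percolation SimpleGraph

namespace Literature.Probability.RandomPlanarGeometry.SAW.HexBW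

/-- The level-`0` (surface) indicator of a site of the row strip: row `0` and odd abscissa — the summand of
`HexBW.bottomVisits₀`. [cite: BeatonBousquetMelouDeGierDuminilCopinGuttmann2014, §3.1 (arXiv v5 p. 8: "We also add a fugacity y to vertices in the surface"; Fig. 6 p. 9)] -/
def surfInd (z : Site 2) : ℕ := if z 1 = 0 ∧ z 0 % 2 = 1 then 1 else 0

namespace StripInsertion

variable {T n : ℕ} {ω : ℕ → Site 2} {x₀ : ℤ} {R : Finset ℤ}

/-! ### Surface cells of a block -/

/-- The test "the cell is a bottom-SURFACE site" (row `0`, odd abscissa). [cite: BeatonBousquetMelouDeGierDuminilCopinGuttmann2014, §3.1 (arXiv v5 p. 8: "We also add a fugacity y to vertices in the surface"; Fig. 6 p. 9)] -/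
def surfTest (z : Site 2) : Bool := decide (z 1 = 0 ∧ z 0 % 2 = 1)

/-- The column map preserves the parity of the abscissa (`σ(x) = x + 4k`), so every anchor keeps its surface class.
[cite: MadrasSlade1993, §8.2, Theorem 8.2.1 (8.2.13), p. 269 (statement; the insertion is the lane's proof)] -/
theorem surfTest_smap (x₀ : ℤ) (R : Finset ℤ) (z : Site 2) : surfTest (smap x₀ R z) = surfTest z := by
  obtain ⟨k, hk⟩ := colMap_eq_add x₀ R (z 0)
  unfold surfTest
  rw [smap_one, smap_zero, hk]
  by_cases h : z 1 = 0 ∧ z 0 % 2 = 1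
  · rw [decide_eq_true h, decide_eq_true ⟨h.1, by omega⟩]
  · rw [decide_eq_false h, decide_eq_false (fun h' => h ⟨h'.1, by omega⟩)]

/-- The `countP` summand of the surface test is the surface indicator. [cite: BeatonBousquetMelouDeGierDuminilCopinGuttmann2014, §3.1 (arXiv v5 p. 8: vertices in the surface; Fig. 6 p. 9)] -/
theorem ite_surfTest (z : Site 2) : (if surfTest z = true then 1 else 0) = surfInd z := by
  by_cases h : z 1 = 0 ∧ z 0 % 2 = 1
  · simp [surfTest, surfInd, h]
  · unfold surfTest surfInd
    rw [decide_eq_false h, if_neg h]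
    simp

/-- A surface cell is a bottom-row cell. [cite: BeatonBousquetMelouDeGierDuminilCopinGuttmann2014, §3.2 (arXiv v5 p. 10: bc(ω), the number of contacts of ω with the bottom of the strip; Fig. 8 p. 11)] -/
theorem row_zero_of_surfTest {z : Site 2} (h : surfTest z = true) : z 1 = 0 := by
  unfold surfTest at h; exact (of_decide_eq_true h).1

/-- A duplicate-free list of planar sites all in the bottom row and in four given columns has length `≤ 4`.
[cite: MadrasSlade1993, §8.2, Theorem 8.2.1 (8.2.13), p. 269] -/
private theorem length_le_four_of_row_zero {l : List (Site 2)} (hN : l.Nodup) {a : ℤ}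
    (hcol : ∀ z ∈ l, a + 1 ≤ z 0 ∧ z 0 ≤ a + 4) (hrow : ∀ z ∈ l, z 1 = 0) : l.length ≤ 4 := by
  classical
  have hinj : Set.InjOn (fun z : Site 2 => z 0) {z | z ∈ l} := by
    intro z hz z' hz' h
    have h' : z 0 = z' 0 := h
    rw [eq_mk z, eq_mk z', h', hrow z hz, hrow z' hz']
  have hN' : (l.map fun z : Site 2 => z 0).Nodup := hN.map_on fun z hz z' hz' h => hinj hz hz' h
  have hsub : (l.map fun z : Site 2 => z 0).toFinset ⊆ Finset.Icc (a + 1) (a + 4) := by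
    intro v hv
    rw [List.mem_toFinset, List.mem_map] at hv
    obtain ⟨z, hz, rfl⟩ := hv
    exact Finset.mem_Icc.2 (hcol z hz)
  have h := Finset.card_le_card hsub
  rw [List.toFinset_card_of_nodup hN', List.length_map, Int.card_Icc] at h
  have e : (a + 4 + 1 - (a + 1)).toNat = 4 := by omega
  omega

/-- Every block is its anchor followed by a rest. [cite: MadrasSlade1993, §8.2, Theorem 8.2.1 (8.2.13), p. 269 (statement; the insertion is the lane's proof)] -/
private theorem block_eq_cons' (T : ℕ) (x₀ : ℤ) (R : Finset ℤ) (ω : ℕ → Site 2) (n t : ℕ) :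
    ∃ rest, block T x₀ R ω n t = smap x₀ R (ω t) :: rest := by
  unfold block; split_ifs <;> exact ⟨_, rfl⟩

/-- **The surface cells of a block**: the anchor contributes `[ω t is a surface site]`; the inserted cells contribute
at most `4`, and nothing unless the step is a crossing of a cut of `R` whose strand lies in the bottom row.
[cite: MadrasSlade1993, §8.2, Theorem 8.2.1 (8.2.13), p. 269 (statement; the insertion is the lane's proof)] -/
theorem countP_surf_block (hW : StripWalk T ω n) {t : ℕ} (ht : t < n) :
    ∃ k : ℕ, (block T x₀ R ω n t).countP surfTest = surfInd (ω t) + k ∧ k ≤ 4 ∧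
      (k ≠ 0 → (ω t 0 ≠ ω (t + 1) 0 ∧ cutOf ω t ∈ R) ∧ ω t 1 = 0) := by
  classical
  obtain ⟨rest, hrest⟩ := block_eq_cons' T x₀ R ω n t
  have hnd := nodup_block (x₀ := x₀) (R := R) hW ht
  rw [hrest, List.nodup_cons] at hnd
  have hrest_mem : ∀ z ∈ rest, (ω t 0 ≠ ω (t + 1) 0 ∧ cutOf ω t ∈ R ∧
      (colMap x₀ R (cutOf ω t) + 1 ≤ z 0 ∧ z 0 ≤ colMap x₀ R (cutOf ω t) + 4) ∧ ω t 1 ≤ z 1) := by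
    intro z hz
    have hz' : z ∈ block T x₀ R ω n t := by rw [hrest]; exact List.mem_cons_of_mem _ hz
    rcases mem_block hW ht hz' with h | ⟨hne, hRc, hcol, hr1, -⟩
    · exact absurd (h ▸ hz) hnd.1
    · exact ⟨hne, hRc, hcol, hr1⟩
  refine ⟨rest.countP surfTest, ?_, ?_, ?_⟩
  · rw [hrest, List.countP_cons, surfTest_smap, ite_surfTest, add_comm]
  · rw [List.countP_eq_length_filter]
    refine length_le_four_of_row_zero (hnd.2.filter _) (a := colMap x₀ R (cutOf ω t))
      (fun z hz => (hrest_mem z (List.mem_of_mem_filter hz)).2.2.1) fun z hz => ?_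
    exact row_zero_of_surfTest (List.mem_filter.1 hz).2
  · intro hk
    obtain ⟨z, hz, hz0⟩ := List.countP_pos_iff.1 (Nat.pos_of_ne_zero hk)
    obtain ⟨hne, hRc, -, hr1⟩ := hrest_mem z hz
    have hz1 : z 1 = 0 := row_zero_of_surfTest hz0
    have h0 := hW.row_nonneg t ht.le
    exact ⟨⟨hne, hRc⟩, by omega⟩

/-! ### Surface cells of the image list -/

/-- The surface vertex count of `ω` on `[0, n]` as a sum of indicators. [cite: BeatonBousquetMelouDeGierDuminilCopinGuttmann2014, §3.2 (arXiv v5 p. 10: bc(ω), the number of contacts of ω with the bottom of the strip; Fig. 8 p. 11)] -/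
def visitsS (ω : ℕ → Site 2) (n : ℕ) : ℕ := ∑ t ∈ Finset.range (n + 1), surfInd (ω t)

/-- A sum over a finite set of terms `≤ 4` of which at most one is nonzero is `≤ 4`. [folklore] -/
private theorem sum_le_four_of_unique' {s : Finset ℕ} {f : ℕ → ℕ} (hle : ∀ t ∈ s, f t ≤ 4)
    (huniq : ∀ t ∈ s, ∀ t' ∈ s, f t ≠ 0 → f t' ≠ 0 → t = t') : ∑ t ∈ s, f t ≤ 4 := by
  classical
  by_cases h : ∃ t ∈ s, f t ≠ 0
  · obtain ⟨t₀, ht₀, hf⟩ := h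
    rw [← Finset.add_sum_erase _ _ ht₀]
    have : ∑ t ∈ s.erase t₀, f t = 0 :=
      Finset.sum_eq_zero fun t ht => by
        by_contra hne
        exact (Finset.ne_of_mem_erase ht) (huniq t (Finset.mem_of_mem_erase ht) t₀ ht₀ hne hf)
    rw [this, add_zero]; exact hle t₀ ht₀
  · push Not at h
    rw [Finset.sum_eq_zero h]; omega

/-- **`i(ω) ≤ i(Ψ(ω,R)) ≤ i(ω) + 4·|R|`** for the surface count, at the level of the image list.
[cite: MadrasSlade1993, §8.2, Theorem 8.2.1 (8.2.13), p. 269 (statement; the insertion is the lane's proof)] -/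
theorem countP_surf_imageList (hW : StripWalk T ω n) :
    visitsS ω n ≤ (imageList T x₀ R ω n).countP surfTest ∧
      (imageList T x₀ R ω n).countP surfTest ≤ visitsS ω n + 4 * R.card := by
  classical
  choose k hk using fun t : {t // t < n} => countP_surf_block (x₀ := x₀) (R := R) hW t.2
  set K : ℕ → ℕ := fun t => if h : t < n then k ⟨t, h⟩ else 0 with hKdef
  have hK : ∀ t, t < n → (block T x₀ R ω n t).countP surfTest = surfInd (ω t) + K t ∧ K t ≤ 4 ∧
      (K t ≠ 0 → (ω t 0 ≠ ω (t + 1) 0 ∧ cutOf ω t ∈ R) ∧ ω t 1 = 0) := by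
    intro t ht
    have := hk ⟨t, ht⟩
    simp only [hKdef, dif_pos ht]
    exact this
  have htot : (imageList T x₀ R ω n).countP surfTest = visitsS ω n + ∑ t ∈ Finset.range n, K t := by
    rw [imageList, List.countP_append, List.countP_flatMap, list_sum_map_range]
    have e1 : ∑ t ∈ Finset.range n, (block T x₀ R ω n t).countP surfTest =
        ∑ t ∈ Finset.range n, (surfInd (ω t) + K t) :=
      Finset.sum_congr rfl fun t ht => (hK t (Finset.mem_range.1 ht)).1
    have e2 : [smap x₀ R (ω n)].countP surfTest = surfInd (ω n) := by
      rw [List.countP_cons, List.countP_nil, surfTest_smap, ite_surfTest, zero_add]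
    rw [Function.comp_def, e1, e2, Finset.sum_add_distrib, visitsS, Finset.sum_range_succ]
    ring
  refine ⟨by rw [htot]; omega, ?_⟩
  rw [htot, add_le_add_iff_left]
  have hzero : ∀ t ∈ Finset.range n, ¬ (ω t 0 ≠ ω (t + 1) 0 ∧ cutOf ω t ∈ R) → K t = 0 := by
    intro t ht h
    by_contra hne
    exact h ((hK t (Finset.mem_range.1 ht)).2.2 hne).1
  rw [← Finset.sum_filter_of_ne (p := fun t => ω t 0 ≠ ω (t + 1) 0 ∧ cutOf ω t ∈ R)
    (fun t ht hne => by by_contra h; exact hne (hzero t ht h))]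
  have hmaps : ∀ t ∈ (Finset.range n).filter (fun t => ω t 0 ≠ ω (t + 1) 0 ∧ cutOf ω t ∈ R),
      cutOf ω t ∈ R := fun t ht => (Finset.mem_filter.1 ht).2.2
  rw [← Finset.sum_fiberwise_of_maps_to hmaps]
  have hinner : ∀ c ∈ R,
      ∑ t ∈ ((Finset.range n).filter (fun t => ω t 0 ≠ ω (t + 1) 0 ∧ cutOf ω t ∈ R)).filter
          (fun t => cutOf ω t = c), K t ≤ 4 := by
    intro c hc
    refine sum_le_four_of_unique' (fun t ht => (hK t ?_).2.1) fun t ht t' ht' hf hf' => ?_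
    · exact Finset.mem_range.1 (Finset.mem_filter.1 (Finset.mem_filter.1 ht).1).1
    · obtain ⟨ht1, htc⟩ := Finset.mem_filter.1 ht
      obtain ⟨ht1', htc'⟩ := Finset.mem_filter.1 ht'
      obtain ⟨htn, hne, -⟩ := Finset.mem_filter.1 ht1
      obtain ⟨htn', hne', -⟩ := Finset.mem_filter.1 ht1'
      rw [Finset.mem_range] at htn htn'
      have hx : t ∈ crossTimes ω n c := by
        rw [crossTimes_eq_filter hW c]; exact Finset.mem_filter.2 ⟨Finset.mem_range.2 htn, hne, htc⟩
      have hx' : t' ∈ crossTimes ω n c := by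
        rw [crossTimes_eq_filter hW c]; exact Finset.mem_filter.2 ⟨Finset.mem_range.2 htn', hne', htc'⟩
      have h0 := ((hK t htn).2.2 hf).2
      have h0' := ((hK t' htn').2.2 hf').2
      exact crossTimes_row_inj hW.inj hW.rows hx hx' (by rw [h0, h0'])
  calc ∑ c ∈ R, ∑ t ∈ ((Finset.range n).filter (fun t => ω t 0 ≠ ω (t + 1) 0 ∧ cutOf ω t ∈ R)).filter
          (fun t => cutOf ω t = c), K t
      ≤ ∑ _c ∈ R, 4 := Finset.sum_le_sum hinner
    _ = 4 * R.card := by rw [Finset.sum_const, smul_eq_mul, mul_comm]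

/-- `countP surfTest` of a cons. [cite: BeatonBousquetMelouDeGierDuminilCopinGuttmann2014, §3.2 (arXiv v5 p. 10: bc(ω), the number of contacts of ω with the bottom of the strip; Fig. 8 p. 11)] -/
theorem countP_surf_cons (a : Site 2) (l : List (Site 2)) :
    (a :: l).countP surfTest = l.countP surfTest + surfInd a := by
  rw [List.countP_cons, ite_surfTest]

/-- Positional sum of the surface indicator along a list = its count (any default value).
[cite: BeatonBousquetMelouDeGierDuminilCopinGuttmann2014, §3.2 (arXiv v5 p. 10: bc(ω), the number of contacts of ω with the bottom of the strip; Fig. 8 p. 11)] -/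
theorem sum_surfInd_getD (d : Site 2) : ∀ l : List (Site 2),
    ∑ t ∈ Finset.range l.length, surfInd ((l[t]?).getD d) = l.countP surfTest
  | [] => by simp
  | a :: l => by
    rw [List.length_cons, Finset.sum_range_succ', countP_surf_cons, ← sum_surfInd_getD d l]
    simp only [List.getElem?_cons_succ, List.getElem?_cons_zero, Option.getD_some]

/-- Reading a list as a vertex function: the surface count is the list count. [cite: BeatonBousquetMelouDeGierDuminilCopinGuttmann2014, §3.2 (arXiv v5 p. 10: bc(ω), the number of contacts of ω with the bottom of the strip; Fig. 8 p. 11)] -/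
theorem visitsS_ofList {l : List (Site 2)} (hl : l ≠ []) :
    visitsS (ofList l) (l.length - 1) = l.countP surfTest := by
  have hlen : l.length - 1 + 1 = l.length := Nat.succ_pred_eq_of_pos (List.length_pos_of_ne_nil hl)
  unfold visitsS
  rw [hlen, ← sum_surfInd_getD (l.getLast?.getD 0) l]
  rfl

end StripInsertion

/-! ### The surface count of the insertion `HexBW.stripInsertion` -/

section Insertion

open StripInsertion

variable {T n : ℕ}

/-- `bottomVisits₀` is the indicator sum `visitsS` of the placed walk. [cite: BeatonBousquetMelouDeGierDuminilCopinGuttmann2014, §3.2 (arXiv v5 p. 10: bc(ω), the number of contacts of ω with the bottom of the strip; Fig. 8 p. 11)] -/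
theorem bottomVisits₀_eq_visitsS (a : Site 2) (υ : ℕ → Site 2) (n : ℕ) :
    bottomVisits₀ a υ n = visitsS (fun t => a + υ t) n := rfl

/-- **`i(ω) ≤ i(Ψ(ω,R)) ≤ i(ω) + 4·|R|` for the insertion of the door «HEX-STRIP-STRICT»**: the number of surface
vertices of the image pair. [cite: MadrasSlade1993, §8.2, Theorem 8.2.1 (8.2.13), p. 269 (statement; the insertion is the lane's proof)]
[cite: BeatonBousquetMelouDeGierDuminilCopinGuttmann2014, Proposition 7 (arXiv v5 p. 11)] -/
theorem bottomVisits₀_stripInsertion (n : ℕ) {p : Site 2 × (ℕ → Site 2)} (R : Finset ℤ) (hp : p ∈ stripPairs T n) :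
    bottomVisits₀ p.1 p.2 n ≤ bottomVisits₀ (stripInsertion T n p R).1 (stripInsertion T n p R).2
        (n + ∑ c ∈ R, stripInsertionCost T n p c) ∧
      bottomVisits₀ (stripInsertion T n p R).1 (stripInsertion T n p R).2 (n + ∑ c ∈ R, stripInsertionCost T n p c) ≤
        bottomVisits₀ p.1 p.2 n + 4 * R.card := by
  obtain ⟨hW, h0⟩ := stripWalk_of_mem hp
  set L := imageList T ((p.1 + p.2 0) 0) R (fun t => p.1 + p.2 t) n with hL
  have hLne : L ≠ [] := imageList_ne_nil _ _ _ _ _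
  have hlen : n + ∑ c ∈ R, stripInsertionCost T n p c = L.length - 1 := by
    rw [hL, length_imageList hW]; unfold stripInsertionCost; omega
  have himg : bottomVisits₀ (stripInsertion T n p R).1 (stripInsertion T n p R).2
      (n + ∑ c ∈ R, stripInsertionCost T n p c) = L.countP surfTest := by
    rw [hlen, bottomVisits₀_eq_visitsS, ← visitsS_ofList hLne]
    unfold visitsS
    refine Finset.sum_congr rfl fun t _ => ?_
    have e : (stripInsertion T n p R).1 + (stripInsertion T n p R).2 t = StripInsertion.ofList L t := by
      simp only [stripInsertion, psi, h0]; rw [hL, h0]; abel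
    show surfInd ((stripInsertion T n p R).1 + (stripInsertion T n p R).2 t) = _
    rw [e]
  have hsrc : bottomVisits₀ p.1 p.2 n = visitsS (fun t => p.1 + p.2 t) n := rfl
  have key := countP_surf_imageList (x₀ := (p.1 + p.2 0) 0) (R := R) hW
  rw [himg, hsrc]
  exact key

/-! ### The weighted core (one-level surface) -/

/-- `y^{i(Ψ)} ≥ y^{i(ω)} · θ^{|R|}` with `θ = min 1 (y^4)`. [cite: BeatonBousquetMelouDeGierDuminilCopinGuttmann2014, Proposition 7 (arXiv v5 p. 11)] -/
theorem pow_bottomVisits₀_stripInsertion_ge (n : ℕ) {p : Site 2 × (ℕ → Site 2)} (R : Finset ℤ)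
    (hp : p ∈ stripPairs T n) {y : ℝ} (hy : 0 < y) :
    y ^ bottomVisits₀ p.1 p.2 n * (min 1 (y ^ 4)) ^ R.card ≤
      y ^ bottomVisits₀ (stripInsertion T n p R).1 (stripInsertion T n p R).2
        (n + ∑ c ∈ R, stripInsertionCost T n p c) := by
  obtain ⟨h1, h2⟩ := bottomVisits₀_stripInsertion n R hp
  set V := bottomVisits₀ p.1 p.2 n
  set V' := bottomVisits₀ (stripInsertion T n p R).1 (stripInsertion T n p R).2
    (n + ∑ c ∈ R, stripInsertionCost T n p c)
  rcases le_or_gt 1 y with hy1 | hy1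
  · have : min 1 (y ^ 4) = 1 := min_eq_left (one_le_pow₀ hy1)
    rw [this, one_pow, mul_one]
    exact pow_le_pow_right₀ hy1 h1
  · have hy4 : y ^ 4 ≤ 1 := pow_le_one₀ hy.le hy1.le
    rw [min_eq_right hy4, ← pow_mul]
    calc y ^ V * y ^ (4 * R.card) = y ^ (V + 4 * R.card) := by rw [pow_add]
      _ ≤ y ^ V' := pow_le_pow_of_le_one hy.le hy1.le h2

/-- **The weighted finite core, one-level surface**: for `y > 0`, `0 < x ≤ 1` and `θ = min 1 (y⁴)`,
`C_{T,n}(y,1) xⁿ (1 + θ x^{4T+8})^{⌊n/(2(T+1))⌋} ≤ Σ_{m ≤ (4T+9)n} C_{T+1,m}(y,1) x^m`.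
[cite: BeatonBousquetMelouDeGierDuminilCopinGuttmann2014, Proposition 7 (arXiv v5 p. 11: μ_T(1,y) < μ_{T+1}(1,y); the insertion and the finite inequality are the lane's)] -/
theorem weighted_core₀ (T n : ℕ) {x y : ℝ} (hx : 0 < x) (hx1 : x ≤ 1) (hy : 0 < y) :
    stripZ₀ T n y * x ^ n * (1 + min 1 (y ^ 4) * x ^ (4 * T + 8)) ^ (n / (2 * (T + 1))) ≤
      ∑ m ∈ Finset.range ((4 * T + 9) * n + 1), stripZ₀ (T + 1) m y * x ^ m := by
  classical
  obtain ⟨hcost, hmem, hinj⟩ := stripInsertion_hyp T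
  set θ := min 1 (y ^ 4) with hθ
  have hθ0 : 0 ≤ θ := le_min zero_le_one (pow_nonneg hy.le 4)
  set F : (Σ _ : Site 2 × (ℕ → Site 2), Finset ℤ) → ℝ := fun q =>
    x ^ insLen (stripInsertionCost T) n q *
      y ^ bottomVisits₀ (stripInsertion T n q.1 q.2).1 (stripInsertion T n q.1 q.2).2 (insLen (stripInsertionCost T) n q)
    with hF
  have hlow : stripZ₀ T n y * x ^ n * (1 + θ * x ^ (4 * T + 8)) ^ (n / (2 * (T + 1))) ≤
      ∑ q ∈ insDom T n, F q := by
    rw [insDom, Finset.sum_sigma, stripZ₀, Finset.sum_mul, Finset.sum_mul]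
    refine Finset.sum_le_sum fun p hp => ?_
    have hp' : (p.1, p.2) ∈ stripPairs T n := hp
    have hstep : y ^ bottomVisits₀ p.1 p.2 n * x ^ n *
        ∏ c ∈ admissibleCuts T p.1 p.2 n, (1 + θ * x ^ stripInsertionCost T n p c) ≤
        ∑ R ∈ (admissibleCuts T p.1 p.2 n).powerset, F ⟨p, R⟩ := by
      rw [Finset.prod_one_add, Finset.mul_sum]
      refine Finset.sum_le_sum fun R hR => ?_
      have hpow := pow_bottomVisits₀_stripInsertion_ge n R hp hy
      show y ^ bottomVisits₀ p.1 p.2 n * x ^ n * ∏ c ∈ R, (θ * x ^ stripInsertionCost T n p c) ≤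
        x ^ (n + ∑ c ∈ R, stripInsertionCost T n p c) *
          y ^ bottomVisits₀ (stripInsertion T n p R).1 (stripInsertion T n p R).2
            (n + ∑ c ∈ R, stripInsertionCost T n p c)
      rw [Finset.prod_mul_distrib, Finset.prod_const, Finset.prod_pow_eq_pow_sum, pow_add]
      calc y ^ bottomVisits₀ p.1 p.2 n * x ^ n * (θ ^ R.card * x ^ ∑ c ∈ R, stripInsertionCost T n p c)
          = x ^ n * x ^ (∑ c ∈ R, stripInsertionCost T n p c) * (y ^ bottomVisits₀ p.1 p.2 n * θ ^ R.card) := by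
            ring
        _ ≤ x ^ n * x ^ (∑ c ∈ R, stripInsertionCost T n p c) *
            y ^ bottomVisits₀ (stripInsertion T n p R).1 (stripInsertion T n p R).2
              (n + ∑ c ∈ R, stripInsertionCost T n p c) :=
            mul_le_mul_of_nonneg_left hpow (by positivity)
    refine le_trans ?_ hstep
    refine mul_le_mul_of_nonneg_left ?_ (by positivity)
    calc (1 + θ * x ^ (4 * T + 8)) ^ (n / (2 * (T + 1)))
        ≤ (1 + θ * x ^ (4 * T + 8)) ^ (admissibleCuts T p.1 p.2 n).card :=
          pow_le_pow_right₀ (by nlinarith [pow_nonneg hx.le (4 * T + 8)]) (div_le_card_admissibleCuts hp')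
      _ = ∏ _c ∈ admissibleCuts T p.1 p.2 n, (1 + θ * x ^ (4 * T + 8)) := (Finset.prod_const _).symm
      _ ≤ ∏ c ∈ admissibleCuts T p.1 p.2 n, (1 + θ * x ^ stripInsertionCost T n p c) :=
          Finset.prod_le_prod (fun c _ => by nlinarith [pow_nonneg hx.le (4 * T + 8)]) fun c hc => by
            have := pow_le_pow_of_le_one hx.le hx1 (hcost n p hp c hc)
            nlinarith
  have hup : ∑ q ∈ insDom T n, F q ≤ ∑ m ∈ Finset.range ((4 * T + 9) * n + 1), stripZ₀ (T + 1) m y * x ^ m := by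
    rw [← Finset.sum_fiberwise_of_maps_to (g := insLen (stripInsertionCost T) n)
      (t := Finset.range ((4 * T + 9) * n + 1)) fun q hq =>
        Finset.mem_range.2 (Nat.lt_succ_of_le (insLen_le (hcost n) hq))]
    refine Finset.sum_le_sum fun m _ => ?_
    have e1 : ∑ q ∈ (insDom T n).filter (fun q => insLen (stripInsertionCost T) n q = m), F q =
        x ^ m * ∑ q ∈ (insDom T n).filter (fun q => insLen (stripInsertionCost T) n q = m),
          y ^ bottomVisits₀ (stripInsertion T n q.1 q.2).1 (stripInsertion T n q.1 q.2).2 m := by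
      rw [Finset.mul_sum]
      refine Finset.sum_congr rfl fun q hq => ?_
      rw [hF]; simp only
      rw [(Finset.mem_filter.1 hq).2]
    rw [e1, mul_comm]
    refine mul_le_mul_of_nonneg_right ?_ (pow_nonneg hx.le m)
    rw [stripZ₀, ← Finset.sum_image (f := fun p' : Site 2 × (ℕ → Site 2) => y ^ bottomVisits₀ p'.1 p'.2 m)
      (g := fun q : (Σ _ : Site 2 × (ℕ → Site 2), Finset ℤ) => stripInsertion T n q.1 q.2)
      (hinj n |>.mono fun q hq => by
        have h := Finset.mem_filter.1 (Finset.mem_coe.1 hq)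
        obtain ⟨h1, h2⟩ := mem_insDom.1 h.1
        exact ⟨h1, h2⟩)]
    refine Finset.sum_le_sum_of_subset_of_nonneg (fun p' hp' => ?_) fun _ _ _ => pow_nonneg hy.le _
    obtain ⟨q, hq, rfl⟩ := Finset.mem_image.1 hp'
    obtain ⟨hq1, hqm⟩ := Finset.mem_filter.1 hq
    obtain ⟨hqp, hqR⟩ := mem_insDom.1 hq1
    have := hmem n q.1 q.2 hqp hqR
    rw [show n + ∑ c ∈ q.2, stripInsertionCost T n q.1 c = m from hqm] at this
    exact this
  exact hlow.trans hup

end Insertion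

end Literature.Probability.RandomPlanarGeometry.SAW.HexBW
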